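import Summits.CriticalPhenomena.PercolationContinuityZ3.Theorems.PercNearOneGluingNoHeavyLowerTailMajorityGluingZThirteenEightP25
import Summits.CriticalPhenomena.PercolationContinuityZ3.Theorems.PercNearOneGluingNoHeavyLowerTailMajorityGluingZThirteenEightP26
import Summits.CriticalPhenomena.PercolationContinuityZ3.Theorems.PercNearOneGluingNoHeavyLowerTailMajorityGluingZThirteenEightP27
import Summits.CriticalPhenomena.PercolationContinuityZ3.Theorems.PercNearOneGluingNoHeavyLowerTailMajorityGluingZThirteenEightP28
import Summits.CriticalPhenomena.PercolationContinuityZ3.Theorems.PercNearOneGluingNoHeavyLowerTailMajorityGluingZThirteenEightP29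
import Summits.CriticalPhenomena.PercolationContinuityZ3.Theorems.PercNearOneGluingNoHeavyLowerTailMajorityGluingZThirteenEightP30
import Summits.CriticalPhenomena.PercolationContinuityZ3.Theorems.PercNearOneGluingNoHeavyLowerTailMajorityGluingZThirteenEightP31
import Summits.CriticalPhenomena.PercolationContinuityZ3.Theorems.PercNearOneGluingNoHeavyLowerTailMajorityGluingZThirteenEightP32
import Summits.CriticalPhenomena.PercolationContinuityZ3.Theorems.PercNearOneGluingNoHeavyLowerTailMajorityGluingZThirteenEightP33
import Summits.CriticalPhenomena.PercolationContinuityZ3.Theorems.PercNearOneGluingNoHeavyLowerTailMajorityGluingZThirteenEightP34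
import Summits.CriticalPhenomena.PercolationContinuityZ3.Theorems.PercNearOneGluingNoHeavyLowerTailMajorityGluingZThirteenEightP35
import Summits.CriticalPhenomena.PercolationContinuityZ3.Theorems.PercNearOneGluingNoHeavyLowerTailMajorityGluingZThirteenEightP36
import Summits.CriticalPhenomena.PercolationContinuityZ3.Theorems.PercNearOneGluingNoHeavyLowerTailMajorityGluingZThirteenEightHG3C1
import Summits.CriticalPhenomena.PercolationContinuityZ3.Theorems.PercNearOneGluingNoHeavyLowerTailMajorityGluingZThirteenEightHG3C2
import Summits.CriticalPhenomena.PercolationContinuityZ3.Theorems.PercNearOneGluingNoHeavyLowerTailMajorityGluingZThirteenEightHG3C3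
import Summits.CriticalPhenomena.PercolationContinuityZ3.Theorems.PercNearOneGluingNoHeavyLowerTailMajorityGluingZThirteenEightHG3C4
import Summits.CriticalPhenomena.PercolationContinuityZ3.Theorems.PercNearOneGluingNoHeavyLowerTailMajorityGluingZThirteenEightHG3C5
import Summits.CriticalPhenomena.PercolationContinuityZ3.Theorems.PercNearOneGluingNoHeavyLowerTailMajorityGluingZThirteenEightHG3C6
import Summits.CriticalPhenomena.PercolationContinuityZ3.Theorems.PercNearOneGluingNoHeavyLowerTailMajorityGluingZRangeAM
import HarnessLib

/-!
# Group 3 of 4 of the `(13,8)` certificate at `c = 11/8`: its aggregate-merge tree IS the concatenation of its 6 key-range chunks (lane prim-rate, constants-miner 1, gen 39; cert/mkhier.py)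

Support file for the closed crux `NoHeavyLowerTail` (stmt-CriticalPhenomena-4575), majority-gluing line.  The 12 parts P25, P26, P27, P28, P29, P30, P31, P32, P33, P34, P35, P36 (kit j311929) carry verified
type-space digests `…D`; `thirteenEightT2G3T` is their binary tree of aggregated merges (`am`, …MajorityGluingZRangeAM, depth 4); the kernel verifies `thirteenEightT2G3T = [chunks].flatten`
(`thirteenEightT2G3_eq`), and `thirteenEightT2G3_val` identifies the value of the group's digests with the value of its chunks (`evalC_am`).  No sorries. [cite: VandenbergKahn2001, Thm 1.2 (p. 123)]
-/

namespace Summit.CriticalPhenomena.PercolationContinuityZ3.Theorems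

namespace HubOnly
namespace QCert

/-- The aggregate-merge tree of group 3. -/
def thirteenEightT2G3T : List (ℕ × ℤ) :=
  am (am (am (am (thirteenEightTP25D) (thirteenEightTP26D)) (am (thirteenEightTP27D) (thirteenEightTP28D))) (am (am (thirteenEightTP29D) (thirteenEightTP30D)) (am (thirteenEightTP31D) (thirteenEightTP32D)))) (am (am (thirteenEightTP33D) (thirteenEightTP34D)) (am (thirteenEightTP35D) (thirteenEightTP36D)))

set_option maxRecDepth 8192 in
set_option maxHeartbeats 0 in
/-- **The tree of group 3 equals the concatenation of its key-range chunks** (kernel evaluation). -/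
theorem thirteenEightT2G3_eq : thirteenEightT2G3T = [thirteenEightT2G3C1, thirteenEightT2G3C2, thirteenEightT2G3C3, thirteenEightT2G3C4, thirteenEightT2G3C5, thirteenEightT2G3C6].flatten := by
  decide +kernel

/-- The tree's value is the value of the group's digests. -/
theorem thirteenEightT2G3_treeVal (val : ℕ → ℝ) : evalC val thirteenEightT2G3T = evalC val [thirteenEightTP25D, thirteenEightTP26D, thirteenEightTP27D, thirteenEightTP28D, thirteenEightTP29D, thirteenEightTP30D, thirteenEightTP31D, thirteenEightTP32D, thirteenEightTP33D, thirteenEightTP34D, thirteenEightTP35D, thirteenEightTP36D].flatten := by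
  simp only [thirteenEightT2G3T, evalC_am, List.flatten_cons, List.flatten_nil, evalC_append, evalC_nil', add_assoc, add_zero]

/-- **The value of group 3's digests is the value of its chunks.** -/
theorem thirteenEightT2G3_val (val : ℕ → ℝ) : evalC val [thirteenEightTP25D, thirteenEightTP26D, thirteenEightTP27D, thirteenEightTP28D, thirteenEightTP29D, thirteenEightTP30D, thirteenEightTP31D, thirteenEightTP32D, thirteenEightTP33D, thirteenEightTP34D, thirteenEightTP35D, thirteenEightTP36D].flatten = evalC val [thirteenEightT2G3C1, thirteenEightT2G3C2, thirteenEightT2G3C3, thirteenEightT2G3C4, thirteenEightT2G3C5, thirteenEightT2G3C6].flatten := by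
  rw [← thirteenEightT2G3_treeVal val, thirteenEightT2G3_eq]

end QCert
end HubOnly

end Summit.CriticalPhenomena.PercolationContinuityZ3.Theorems
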